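import Summits.RiemannHypothesis.RiemannHypothesis.Theorems.WeilFormatCCinfRowCollected
import Summits.RiemannHypothesis.RiemannHypothesis.Theorems.WeilFormatCCinfImageCollectedEven
import Summits.RiemannHypothesis.RiemannHypothesis.Theorems.WeilFormatCCinfVTable
import Summits.RiemannHypothesis.RiemannHypothesis.Theorems.WeilFormatCCinfGramHankel
import Summits.RiemannHypothesis.RiemannHypothesis.Theorems.WeilFormatCCinfWeights
import Summits.RiemannHypothesis.RiemannHypothesis.Theorems.WeilFormatCCinfRemainders
import Summits.RiemannHypothesis.RiemannHypothesis.Theorems.WeilFormatCCinfReindex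
import HarnessLib

/-!
# Format C, design C∞: the EVEN sector's analytic facts (rows, profile table and remainder weight), TRUNCATED at power `E₀` — families over `Fin 4 × Fin E₀`

Route context: Fourier–Galerkin / Schur-complement certificates of Weil positivity on a window ("format C", C∞ door;
cell memo `run/shared/lean/pub/rh-explicit/rh-explicit-weil-10/KERNEL-LEVER.md` §22; supporting stmt-RiemannHypothesis-0098;
seat rh-explicit-weil-10).  Companion of `WeilFormatCCinfFactsEven`: the same facts in the same hypothesis shapes of the
C∞ doors, with the rows/images cut at power `E₀` (`E + 1 ≤ E₀ ≤ D`) by the ℕ-indexed truncation (`WeilFormatCCinfTruncateNat`,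
local copy here) BEFORE weil-2's rescaling, so the family index is `Fin 4 × Fin E₀` (Hankel boxes only for `s ≤ 2E₀`) and the
remainders grow by the finite tails `Σ_{x.2 > E₀} |P(x)|·τ/m₀^{x.2}`.  Assembly only; standard axioms; no definitions; no RH claim.
-/

set_option autoImplicit false
-- `Summit.RiemannHypothesis.RiemannHypothesis.…` is the layout-mandated namespace (summit = problem name).
set_option linter.dupNamespace false

noncomputable section

open Complex Filter Set MeasureTheory Finset
open scoped Real Topology ComplexConjugate ArithmeticFunction.vonMangoldt

namespace Summit.RiemannHypothesis.RiemannHypothesis.Theorems.WeilFormatC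

open Literature.NumberTheory.LFunctions Literature.NumberTheory.LFunctions.Yoshida1992
  Literature.Analysis.SpecialFunctions

variable {a : ℝ}

/-- Local copy of `collected_truncate_nat` (`WeilFormatCCinfTruncateNat`, filed in parallel; no hub olean yet). -/
private theorem collected_truncate_nat_loc {X ε ρ : ℝ} {m₀ m : ℕ} (hm₀ : 1 ≤ m₀) (hm : m₀ ≤ m) {D E E₀ : ℕ}
    (hE : E + 1 ≤ E₀) (hED : E₀ ≤ D) (hε : |ε| ≤ 1) (P : Fin 4 → ℕ → ℝ)
    (h : |X - ε * ∑ x : Fin 4 × Fin (D + 1), P x.1 x.2 *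
        (![(1 : ℝ), Real.log m, -(∑ n ∈ weilPrimeIndex a, (Λ n : ℝ) / Real.sqrt n * Real.cos (π * m / a * Real.log n)), (∑ n ∈ weilPrimeIndex a, (Λ n : ℝ) / Real.sqrt n * Real.sin (π * m / a * Real.log n))] x.1 / (m : ℝ) ^ (x.2 : ℕ))| ≤ ρ * ((m₀ : ℝ) / m) ^ (E + 1)) :
    |X - ε * ∑ y : Fin 4 × Fin (E₀ + 1), P y.1 y.2 *
        (![(1 : ℝ), Real.log m, -(∑ n ∈ weilPrimeIndex a, (Λ n : ℝ) / Real.sqrt n * Real.cos (π * m / a * Real.log n)), (∑ n ∈ weilPrimeIndex a, (Λ n : ℝ) / Real.sqrt n * Real.sin (π * m / a * Real.log n))] y.1 / (m : ℝ) ^ (y.2 : ℕ))|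
      ≤ (ρ + ∑ x : Fin 4 × Fin (D + 1), if E₀ < (x.2 : ℕ) then |P x.1 x.2| * (![(1 : ℝ), (m₀ : ℝ), ∑ n ∈ weilPrimeIndex a, (Λ n : ℝ) / Real.sqrt n, ∑ n ∈ weilPrimeIndex a, (Λ n : ℝ) / Real.sqrt n] x.1) / (m₀ : ℝ) ^ (x.2 : ℕ) else 0) * ((m₀ : ℝ) / m) ^ (E + 1) := by
  have ht := collected_truncate (a := a) hm₀ hm hE hε (fun x : Fin 4 × Fin (D + 1) ↦ P x.1 x.2) h
  rw [sum_trunc_eq_sum_castLE hED (fun x : Fin 4 × Fin (D + 1) ↦ P x.1 x.2) (fun t d ↦ (![(1 : ℝ), Real.log m, -(∑ n ∈ weilPrimeIndex a, (Λ n : ℝ) / Real.sqrt n * Real.cos (π * m / a * Real.log n)), (∑ n ∈ weilPrimeIndex a, (Λ n : ℝ) / Real.sqrt n * Real.sin (π * m / a * Real.log n))] t) / (m : ℝ) ^ d)] at ht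
  simp only [Fin.val_castLE] at ht
  exact ht

/-- Local copy of `truncation_tail_nonneg` (`WeilFormatCCinfTruncateNat`). -/
private theorem truncation_tail_nonneg_loc (a : ℝ) (m₀ : ℕ) {D : ℕ} (E₀ : ℕ) (P : Fin 4 → ℕ → ℝ) :
    0 ≤ ∑ x : Fin 4 × Fin (D + 1), if E₀ < (x.2 : ℕ) then |P x.1 x.2| * (![(1 : ℝ), (m₀ : ℝ), ∑ n ∈ weilPrimeIndex a, (Λ n : ℝ) / Real.sqrt n, ∑ n ∈ weilPrimeIndex a, (Λ n : ℝ) / Real.sqrt n] x.1) / (m₀ : ℝ) ^ (x.2 : ℕ) else 0 := by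
  refine Finset.sum_nonneg fun x _ ↦ ?_
  split_ifs
  · have hL : 0 ≤ ∑ n ∈ weilPrimeIndex a, (Λ n : ℝ) / Real.sqrt n :=
      Finset.sum_nonneg fun n _ ↦ div_nonneg ArithmeticFunction.vonMangoldt_nonneg (Real.sqrt_nonneg _)
    have hτ : 0 ≤ (![(1 : ℝ), (m₀ : ℝ), ∑ n ∈ weilPrimeIndex a, (Λ n : ℝ) / Real.sqrt n, ∑ n ∈ weilPrimeIndex a, (Λ n : ℝ) / Real.sqrt n] x.1) := by
      rcases x with ⟨t, d⟩
      fin_cases t <;> simp [hL]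
    positivity
  · exact le_rfl


set_option maxHeartbeats 400000 in
/-- **Even sector, cut at `E₀`: rows + profile table + remainder weight** — `(∀ n, 0 ≤ ρrowe n) ∧ hrowe ∧ hVe ∧ hWe` for the
rescaled families on `Fin 4 × Fin E₀` (images: `cinf_facts_even_truncB`). -/
theorem cinf_facts_even_truncA (ha : 0 < a) {Be re m₀ : ℕ} (hm₀ : 2 ≤ π * m₀ / a) (hB2 : 2 * Be ≤ m₀) (hm₀2 : 2 ≤ m₀)
    (se : Finset ℕ) (coefe : Fin re → ℕ → ℝ)
    {ν : ℕ} (hν : ν ≠ 0) {K : ℕ} (hK : 2 * ν ≤ K) {R J E D : ℕ} (hE1 : E + 1 ≤ 2 * ν)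
    (hE2 : E ≤ K) (hE3 : E ≤ 2 * R) (hEJ : E ≤ 2 * J) (hD1 : K + 2 * J ≤ D + 1) (hD2 : 2 * R + 2 * J ≤ D + 2)
    {E₀ : ℕ} (hE0 : E + 1 ≤ E₀) (hE0D : E₀ ≤ D) (hDq : ∀ q ∈ se, q + 1 ≤ E₀) :
    -- hρrowe
    (∀ n : ℕ, 0 ≤ (fun n : ℕ ↦ (((4 * Real.pi ^ 2 / 3 * ((2 * ν + 1).factorial : ℝ) / (2 * Real.pi) ^ (2 * ν + 1)
                * (4 * (1 / (4 * (π * m₀ / a / 2)))) ^ (2 * ν)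
              + (1 / (4 * (π * m₀ / a / 2))) ^ (K + 1) / ((K + 1) * (1 - 1 / (4 * (π * m₀ / a / 2))))
              + 2 * (1 / (4 * (π * m₀ / a / 2))) ^ (K + 1)
              + ∑ k ∈ Finset.Icc 1 ν, |(bernoulli (2 * k) : ℝ) / (2 * k)| * 2 ^ (K + 1 + 4 * k)
                  * (1 / (4 * (π * m₀ / a / 2))) ^ (K + 1)) / 2
            + (∑' k : ℕ, Real.exp (-(2 * a * digammaNode k)) * digammaNode k ^ (2 * R))
                / |π * m₀ / a| ^ (2 * R + 1)) / π
            * ∑ j ∈ Finset.range J, (n : ℝ) ^ (2 * j) / (m₀ : ℝ) ^ (2 * j + 1)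
          + (2 * (π / 4 + (∑ k ∈ weilPrimeIndex a, (Λ k : ℝ) / Real.sqrt k) + a * (1 + weilArchDensity (2 * a)) / π)
                * (n : ℝ) ^ (2 * J) / π
              + 4 / a * (Real.exp (a / 2) - Real.exp (-(a / 2))) ^ 2 * (a ^ 2 / (4 * π ^ 2)) ^ (J + 1)
                * (1 / (1 + 4 * freq a n ^ 2))) / (m₀ : ℝ) ^ (2 * J + 1))
        + ∑ x : Fin 4 × Fin (D + 1), if E₀ < (x.2 : ℕ) then
          |(fun t d ↦ (![fun d : ℕ ↦ (∑ j ∈ (Finset.range J).filter (fun j ↦ (2 * j + 1) = d),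
                π / 4 * ((-1 : ℝ) ^ n * (n : ℝ) ^ (2 * j)) / Real.pi)
              + (∑ p ∈ (Finset.Icc 1 K ×ˢ Finset.range J).filter (fun p ↦ p.1 + (2 * p.2 + 1) = d),
                  (fun N : ℕ ↦ (if N % 4 = 1 then (1 : ℝ) else if N % 4 = 3 then -1 else 0)
              * (1 - 1 / (2 * (N : ℝ))
                  - (∑ l ∈ Finset.Icc 1 ν, (bernoulli (2 * l) : ℝ) / (2 * l) * 16 ^ l
                      * (((N - 1).choose (2 * l - 1) : ℕ) : ℝ)) / 2)
              * (a / (2 * π)) ^ N) p.1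
                    * ((-1 : ℝ) ^ n * (n : ℝ) ^ (2 * p.2)) / Real.pi)
              - (∑ p ∈ (Finset.range R ×ˢ Finset.range J).filter (fun p ↦ (2 * p.1 + 1) + (2 * p.2 + 1) = d),
                  (fun r : ℕ ↦ (-1 : ℝ) ^ r *
              (∑' l : ℕ, Real.exp (-(2 * a * digammaNode l)) * digammaNode l ^ (2 * r)) * (a / π) ^ (2 * r + 1)) p.1
                    * ((-1 : ℝ) ^ n * (n : ℝ) ^ (2 * p.2)) / Real.pi)
              + (∑ r ∈ (Finset.range J).filter (fun r ↦ (2 * r + 2) = d),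
                  (fun r : ℕ ↦ (-1 : ℝ) ^ n *
              (-((n : ℝ) ^ (2 * r + 1)) * ((Complex.digamma (1 / 4 + ((freq a n : ℝ) : ℂ) / 2 * I)).im / 2
                  + (∑ k ∈ weilPrimeIndex a, (Λ k : ℝ) / Real.sqrt k * Real.sin (freq a n * Real.log k))
                  - archExpSumSin a n) / π
                + 4 / a * (Real.exp (a / 2) - Real.exp (-(a / 2))) ^ 2 * (-1 : ℝ) ^ r * (a ^ 2 / (4 * π ^ 2)) ^ (r + 1)
                  * (1 / (1 + 4 * freq a n ^ 2)))) r),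
                fun _ ↦ 0, fun _ ↦ 0,
                fun d : ℕ ↦ ∑ j ∈ (Finset.range J).filter (fun j ↦ (2 * j + 1) = d),
                ((-1 : ℝ) ^ n * (n : ℝ) ^ (2 * j)) / Real.pi] t) d) x.1 x.2| * (![(1 : ℝ), (m₀ : ℝ), ∑ n ∈ weilPrimeIndex a, (Λ n : ℝ) / Real.sqrt n, ∑ n ∈ weilPrimeIndex a, (Λ n : ℝ) / Real.sqrt n] x.1) / (m₀ : ℝ) ^ (x.2 : ℕ) else 0) n)
    ∧ -- hrowe
    (∀ m, m₀ ≤ m → ∀ n, n ≤ Be →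
      |(if n = 0 then gramCoeff a 0 m else if m = 0 then gramCoeff a n 0
          else (gramCoeff a n m + gramCoeff a n (-(m : ℤ))) / 2)
        - (-1 : ℝ) ^ m * ∑ f : Fin 4 × Fin E₀, (fun (n : ℕ) (x : Fin 4 × Fin E₀) ↦ ((![fun d : ℕ ↦ (∑ j ∈ (Finset.range J).filter (fun j ↦ (2 * j + 1) = d),
                π / 4 * ((-1 : ℝ) ^ n * (n : ℝ) ^ (2 * j)) / Real.pi)
              + (∑ p ∈ (Finset.Icc 1 K ×ˢ Finset.range J).filter (fun p ↦ p.1 + (2 * p.2 + 1) = d),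
                  (fun N : ℕ ↦ (if N % 4 = 1 then (1 : ℝ) else if N % 4 = 3 then -1 else 0)
              * (1 - 1 / (2 * (N : ℝ))
                  - (∑ l ∈ Finset.Icc 1 ν, (bernoulli (2 * l) : ℝ) / (2 * l) * 16 ^ l
                      * (((N - 1).choose (2 * l - 1) : ℕ) : ℝ)) / 2)
              * (a / (2 * π)) ^ N) p.1
                    * ((-1 : ℝ) ^ n * (n : ℝ) ^ (2 * p.2)) / Real.pi)
              - (∑ p ∈ (Finset.range R ×ˢ Finset.range J).filter (fun p ↦ (2 * p.1 + 1) + (2 * p.2 + 1) = d),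
                  (fun r : ℕ ↦ (-1 : ℝ) ^ r *
              (∑' l : ℕ, Real.exp (-(2 * a * digammaNode l)) * digammaNode l ^ (2 * r)) * (a / π) ^ (2 * r + 1)) p.1
                    * ((-1 : ℝ) ^ n * (n : ℝ) ^ (2 * p.2)) / Real.pi)
              + (∑ r ∈ (Finset.range J).filter (fun r ↦ (2 * r + 2) = d),
                  (fun r : ℕ ↦ (-1 : ℝ) ^ n *
              (-((n : ℝ) ^ (2 * r + 1)) * ((Complex.digamma (1 / 4 + ((freq a n : ℝ) : ℂ) / 2 * I)).im / 2
                  + (∑ k ∈ weilPrimeIndex a, (Λ k : ℝ) / Real.sqrt k * Real.sin (freq a n * Real.log k))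
                  - archExpSumSin a n) / π
                + 4 / a * (Real.exp (a / 2) - Real.exp (-(a / 2))) ^ 2 * (-1 : ℝ) ^ r * (a ^ 2 / (4 * π ^ 2)) ^ (r + 1)
                  * (1 / (1 + 4 * freq a n ^ 2)))) r),
                fun _ ↦ 0, fun _ ↦ 0,
                fun d : ℕ ↦ ∑ j ∈ (Finset.range J).filter (fun j ↦ (2 * j + 1) = d),
                ((-1 : ℝ) ^ n * (n : ℝ) ^ (2 * j)) / Real.pi] x.1) ((x.2 : ℕ) + 1) / (m₀ : ℝ) ^ ((x.2 : ℕ) + 1))) n f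
            * (fun (x : Fin 4 × Fin E₀) (m : ℕ) ↦ ![(1 : ℝ), Real.log m, -(∑ n ∈ weilPrimeIndex a, (Λ n : ℝ) / Real.sqrt n * Real.cos (π * m / a * Real.log n)), (∑ n ∈ weilPrimeIndex a, (Λ n : ℝ) / Real.sqrt n * Real.sin (π * m / a * Real.log n))] x.1 * ((m₀ : ℝ) / (m : ℝ)) ^ ((x.2 : ℕ) + 1)) f m|
        ≤ (fun n : ℕ ↦ (((4 * Real.pi ^ 2 / 3 * ((2 * ν + 1).factorial : ℝ) / (2 * Real.pi) ^ (2 * ν + 1)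
                * (4 * (1 / (4 * (π * m₀ / a / 2)))) ^ (2 * ν)
              + (1 / (4 * (π * m₀ / a / 2))) ^ (K + 1) / ((K + 1) * (1 - 1 / (4 * (π * m₀ / a / 2))))
              + 2 * (1 / (4 * (π * m₀ / a / 2))) ^ (K + 1)
              + ∑ k ∈ Finset.Icc 1 ν, |(bernoulli (2 * k) : ℝ) / (2 * k)| * 2 ^ (K + 1 + 4 * k)
                  * (1 / (4 * (π * m₀ / a / 2))) ^ (K + 1)) / 2
            + (∑' k : ℕ, Real.exp (-(2 * a * digammaNode k)) * digammaNode k ^ (2 * R))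
                / |π * m₀ / a| ^ (2 * R + 1)) / π
            * ∑ j ∈ Finset.range J, (n : ℝ) ^ (2 * j) / (m₀ : ℝ) ^ (2 * j + 1)
          + (2 * (π / 4 + (∑ k ∈ weilPrimeIndex a, (Λ k : ℝ) / Real.sqrt k) + a * (1 + weilArchDensity (2 * a)) / π)
                * (n : ℝ) ^ (2 * J) / π
              + 4 / a * (Real.exp (a / 2) - Real.exp (-(a / 2))) ^ 2 * (a ^ 2 / (4 * π ^ 2)) ^ (J + 1)
                * (1 / (1 + 4 * freq a n ^ 2))) / (m₀ : ℝ) ^ (2 * J + 1))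
        + ∑ x : Fin 4 × Fin (D + 1), if E₀ < (x.2 : ℕ) then
          |(fun t d ↦ (![fun d : ℕ ↦ (∑ j ∈ (Finset.range J).filter (fun j ↦ (2 * j + 1) = d),
                π / 4 * ((-1 : ℝ) ^ n * (n : ℝ) ^ (2 * j)) / Real.pi)
              + (∑ p ∈ (Finset.Icc 1 K ×ˢ Finset.range J).filter (fun p ↦ p.1 + (2 * p.2 + 1) = d),
                  (fun N : ℕ ↦ (if N % 4 = 1 then (1 : ℝ) else if N % 4 = 3 then -1 else 0)
              * (1 - 1 / (2 * (N : ℝ))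
                  - (∑ l ∈ Finset.Icc 1 ν, (bernoulli (2 * l) : ℝ) / (2 * l) * 16 ^ l
                      * (((N - 1).choose (2 * l - 1) : ℕ) : ℝ)) / 2)
              * (a / (2 * π)) ^ N) p.1
                    * ((-1 : ℝ) ^ n * (n : ℝ) ^ (2 * p.2)) / Real.pi)
              - (∑ p ∈ (Finset.range R ×ˢ Finset.range J).filter (fun p ↦ (2 * p.1 + 1) + (2 * p.2 + 1) = d),
                  (fun r : ℕ ↦ (-1 : ℝ) ^ r *
              (∑' l : ℕ, Real.exp (-(2 * a * digammaNode l)) * digammaNode l ^ (2 * r)) * (a / π) ^ (2 * r + 1)) p.1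
                    * ((-1 : ℝ) ^ n * (n : ℝ) ^ (2 * p.2)) / Real.pi)
              + (∑ r ∈ (Finset.range J).filter (fun r ↦ (2 * r + 2) = d),
                  (fun r : ℕ ↦ (-1 : ℝ) ^ n *
              (-((n : ℝ) ^ (2 * r + 1)) * ((Complex.digamma (1 / 4 + ((freq a n : ℝ) : ℂ) / 2 * I)).im / 2
                  + (∑ k ∈ weilPrimeIndex a, (Λ k : ℝ) / Real.sqrt k * Real.sin (freq a n * Real.log k))
                  - archExpSumSin a n) / π
                + 4 / a * (Real.exp (a / 2) - Real.exp (-(a / 2))) ^ 2 * (-1 : ℝ) ^ r * (a ^ 2 / (4 * π ^ 2)) ^ (r + 1)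
                  * (1 / (1 + 4 * freq a n ^ 2)))) r),
                fun _ ↦ 0, fun _ ↦ 0,
                fun d : ℕ ↦ ∑ j ∈ (Finset.range J).filter (fun j ↦ (2 * j + 1) = d),
                ((-1 : ℝ) ^ n * (n : ℝ) ^ (2 * j)) / Real.pi] t) d) x.1 x.2| * (![(1 : ℝ), (m₀ : ℝ), ∑ n ∈ weilPrimeIndex a, (Λ n : ℝ) / Real.sqrt n, ∑ n ∈ weilPrimeIndex a, (Λ n : ℝ) / Real.sqrt n] x.1) / (m₀ : ℝ) ^ (x.2 : ℕ) else 0) n * (fun m : ℕ ↦ ((m₀ : ℝ) / m) ^ (E + 1)) m)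
    ∧ -- hV
    (∀ m, m₀ ≤ m → ∀ j : Fin re,
      (if m = 0 then (1 : ℝ) else 2) * (Yoshida1992.fourierCoeff a m
          ((Icc (-a) a).indicator fun x : ℝ ↦ ∑ q ∈ se, ((coefe j q : ℝ) : ℂ) * ((x : ℂ)) ^ q)).re / Real.sqrt (2 * a)
        = (-1 : ℝ) ^ m * ∑ f : Fin 4 × Fin E₀, (fun (j : Fin re) (x : Fin 4 × Fin E₀) ↦ ((![fun d : ℕ ↦ ∑ p ∈ (se.sigma fun q ↦ Finset.range (q + 1)).filter (fun p ↦ p.2 + 1 = d),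
              2 * coefe j p.1 * ((-1 : ℝ) ^ p.2 * (p.1.descFactorial p.2 : ℝ) * (a ^ (p.1 - p.2) - (-a) ^ (p.1 - p.2))
                * (a / π) ^ (p.2 + 1) * (I ^ (p.2 + 1)).re) / Real.sqrt (2 * a),
              fun _ ↦ 0, fun _ ↦ 0, fun _ ↦ 0] x.1) ((x.2 : ℕ) + 1) / (m₀ : ℝ) ^ ((x.2 : ℕ) + 1))) j f
            * (fun (x : Fin 4 × Fin E₀) (m : ℕ) ↦ ![(1 : ℝ), Real.log m, -(∑ n ∈ weilPrimeIndex a, (Λ n : ℝ) / Real.sqrt n * Real.cos (π * m / a * Real.log n)), (∑ n ∈ weilPrimeIndex a, (Λ n : ℝ) / Real.sqrt n * Real.sin (π * m / a * Real.log n))] x.1 * ((m₀ : ℝ) / (m : ℝ)) ^ ((x.2 : ℕ) + 1)) f m)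
    ∧ -- hW
    (∀ N, ∑ m ∈ Ico m₀ N, ((fun m : ℕ ↦ ((m₀ : ℝ) / m) ^ (E + 1)) m) ^ 2
        ≤ (m₀ : ℝ) ^ (2 * E + 2) / ((2 * E + 1 : ℝ) * (((m₀ - 1 : ℕ) : ℝ)) ^ (2 * E + 1))) := by
  have hm₀r : (m₀ : ℝ) ≠ 0 := by exact_mod_cast (show m₀ ≠ 0 by omega)
  have hε : ∀ m : ℕ, |(-1 : ℝ) ^ m| ≤ 1 := fun m ↦ by rw [abs_pow, abs_neg, abs_one, one_pow]
  refine ⟨fun n ↦ add_nonneg (evenRow_remainder_nonneg ha hm₀ n ν K R J)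
      (truncation_tail_nonneg_loc a m₀ E₀ (fun t d ↦ (![fun d : ℕ ↦ (∑ j ∈ (Finset.range J).filter (fun j ↦ (2 * j + 1) = d),
                π / 4 * ((-1 : ℝ) ^ n * (n : ℝ) ^ (2 * j)) / Real.pi)
              + (∑ p ∈ (Finset.Icc 1 K ×ˢ Finset.range J).filter (fun p ↦ p.1 + (2 * p.2 + 1) = d),
                  (fun N : ℕ ↦ (if N % 4 = 1 then (1 : ℝ) else if N % 4 = 3 then -1 else 0)
              * (1 - 1 / (2 * (N : ℝ))
                  - (∑ l ∈ Finset.Icc 1 ν, (bernoulli (2 * l) : ℝ) / (2 * l) * 16 ^ l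
                      * (((N - 1).choose (2 * l - 1) : ℕ) : ℝ)) / 2)
              * (a / (2 * π)) ^ N) p.1
                    * ((-1 : ℝ) ^ n * (n : ℝ) ^ (2 * p.2)) / Real.pi)
              - (∑ p ∈ (Finset.range R ×ˢ Finset.range J).filter (fun p ↦ (2 * p.1 + 1) + (2 * p.2 + 1) = d),
                  (fun r : ℕ ↦ (-1 : ℝ) ^ r *
              (∑' l : ℕ, Real.exp (-(2 * a * digammaNode l)) * digammaNode l ^ (2 * r)) * (a / π) ^ (2 * r + 1)) p.1
                    * ((-1 : ℝ) ^ n * (n : ℝ) ^ (2 * p.2)) / Real.pi)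
              + (∑ r ∈ (Finset.range J).filter (fun r ↦ (2 * r + 2) = d),
                  (fun r : ℕ ↦ (-1 : ℝ) ^ n *
              (-((n : ℝ) ^ (2 * r + 1)) * ((Complex.digamma (1 / 4 + ((freq a n : ℝ) : ℂ) / 2 * I)).im / 2
                  + (∑ k ∈ weilPrimeIndex a, (Λ k : ℝ) / Real.sqrt k * Real.sin (freq a n * Real.log k))
                  - archExpSumSin a n) / π
                + 4 / a * (Real.exp (a / 2) - Real.exp (-(a / 2))) ^ 2 * (-1 : ℝ) ^ r * (a ^ 2 / (4 * π ^ 2)) ^ (r + 1)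
                  * (1 / (1 + 4 * freq a n ^ 2)))) r),
                fun _ ↦ 0, fun _ ↦ 0,
                fun d : ℕ ↦ ∑ j ∈ (Finset.range J).filter (fun j ↦ (2 * j + 1) = d),
                ((-1 : ℝ) ^ n * (n : ℝ) ^ (2 * j)) / Real.pi] t) d)),
    fun m hm n hn ↦ ?_, fun m hm j ↦ ?_, fun N ↦ ?_⟩
  · have h0 := abs_evenRow_sub_family_le ha hm₀ hm (i := n) (by omega) hν hK (R := R) (J := J) hE1 hE2 hE3 hEJ hD1 hD2
    have h := collected_truncate_nat_loc (by omega) hm hE0 hE0D (hε m) (fun t d ↦ (![fun d : ℕ ↦ (∑ j ∈ (Finset.range J).filter (fun j ↦ (2 * j + 1) = d),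
                π / 4 * ((-1 : ℝ) ^ n * (n : ℝ) ^ (2 * j)) / Real.pi)
              + (∑ p ∈ (Finset.Icc 1 K ×ˢ Finset.range J).filter (fun p ↦ p.1 + (2 * p.2 + 1) = d),
                  (fun N : ℕ ↦ (if N % 4 = 1 then (1 : ℝ) else if N % 4 = 3 then -1 else 0)
              * (1 - 1 / (2 * (N : ℝ))
                  - (∑ l ∈ Finset.Icc 1 ν, (bernoulli (2 * l) : ℝ) / (2 * l) * 16 ^ l
                      * (((N - 1).choose (2 * l - 1) : ℕ) : ℝ)) / 2)
              * (a / (2 * π)) ^ N) p.1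
                    * ((-1 : ℝ) ^ n * (n : ℝ) ^ (2 * p.2)) / Real.pi)
              - (∑ p ∈ (Finset.range R ×ˢ Finset.range J).filter (fun p ↦ (2 * p.1 + 1) + (2 * p.2 + 1) = d),
                  (fun r : ℕ ↦ (-1 : ℝ) ^ r *
              (∑' l : ℕ, Real.exp (-(2 * a * digammaNode l)) * digammaNode l ^ (2 * r)) * (a / π) ^ (2 * r + 1)) p.1
                    * ((-1 : ℝ) ^ n * (n : ℝ) ^ (2 * p.2)) / Real.pi)
              + (∑ r ∈ (Finset.range J).filter (fun r ↦ (2 * r + 2) = d),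
                  (fun r : ℕ ↦ (-1 : ℝ) ^ n *
              (-((n : ℝ) ^ (2 * r + 1)) * ((Complex.digamma (1 / 4 + ((freq a n : ℝ) : ℂ) / 2 * I)).im / 2
                  + (∑ k ∈ weilPrimeIndex a, (Λ k : ℝ) / Real.sqrt k * Real.sin (freq a n * Real.log k))
                  - archExpSumSin a n) / π
                + 4 / a * (Real.exp (a / 2) - Real.exp (-(a / 2))) ^ 2 * (-1 : ℝ) ^ r * (a ^ 2 / (4 * π ^ 2)) ^ (r + 1)
                  * (1 / (1 + 4 * freq a n ^ 2)))) r),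
                fun _ ↦ 0, fun _ ↦ 0,
                fun d : ℕ ↦ ∑ j ∈ (Finset.range J).filter (fun j ↦ (2 * j + 1) = d),
                ((-1 : ℝ) ^ n * (n : ℝ) ^ (2 * j)) / Real.pi] t) d) h0
    beta_reduce
    exact cinf_collected_rescale (fun t d ↦ (![fun d : ℕ ↦ (∑ j ∈ (Finset.range J).filter (fun j ↦ (2 * j + 1) = d),
                π / 4 * ((-1 : ℝ) ^ n * (n : ℝ) ^ (2 * j)) / Real.pi)
              + (∑ p ∈ (Finset.Icc 1 K ×ˢ Finset.range J).filter (fun p ↦ p.1 + (2 * p.2 + 1) = d),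
                  (fun N : ℕ ↦ (if N % 4 = 1 then (1 : ℝ) else if N % 4 = 3 then -1 else 0)
              * (1 - 1 / (2 * (N : ℝ))
                  - (∑ l ∈ Finset.Icc 1 ν, (bernoulli (2 * l) : ℝ) / (2 * l) * 16 ^ l
                      * (((N - 1).choose (2 * l - 1) : ℕ) : ℝ)) / 2)
              * (a / (2 * π)) ^ N) p.1
                    * ((-1 : ℝ) ^ n * (n : ℝ) ^ (2 * p.2)) / Real.pi)
              - (∑ p ∈ (Finset.range R ×ˢ Finset.range J).filter (fun p ↦ (2 * p.1 + 1) + (2 * p.2 + 1) = d),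
                  (fun r : ℕ ↦ (-1 : ℝ) ^ r *
              (∑' l : ℕ, Real.exp (-(2 * a * digammaNode l)) * digammaNode l ^ (2 * r)) * (a / π) ^ (2 * r + 1)) p.1
                    * ((-1 : ℝ) ^ n * (n : ℝ) ^ (2 * p.2)) / Real.pi)
              + (∑ r ∈ (Finset.range J).filter (fun r ↦ (2 * r + 2) = d),
                  (fun r : ℕ ↦ (-1 : ℝ) ^ n *
              (-((n : ℝ) ^ (2 * r + 1)) * ((Complex.digamma (1 / 4 + ((freq a n : ℝ) : ℂ) / 2 * I)).im / 2
                  + (∑ k ∈ weilPrimeIndex a, (Λ k : ℝ) / Real.sqrt k * Real.sin (freq a n * Real.log k))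
                  - archExpSumSin a n) / π
                + 4 / a * (Real.exp (a / 2) - Real.exp (-(a / 2))) ^ 2 * (-1 : ℝ) ^ r * (a ^ 2 / (4 * π ^ 2)) ^ (r + 1)
                  * (1 / (1 + 4 * freq a n ^ 2)))) r),
                fun _ ↦ 0, fun _ ↦ 0,
                fun d : ℕ ↦ ∑ j ∈ (Finset.range J).filter (fun j ↦ (2 * j + 1) = d),
                ((-1 : ℝ) ^ n * (n : ℝ) ^ (2 * j)) / Real.pi] t) d) (fun t ↦ by fin_cases t <;> simp) (![(1 : ℝ), Real.log m, -(∑ n ∈ weilPrimeIndex a, (Λ n : ℝ) / Real.sqrt n * Real.cos (π * m / a * Real.log n)), (∑ n ∈ weilPrimeIndex a, (Λ n : ℝ) / Real.sqrt n * Real.sin (π * m / a * Real.log n))]) (m : ℝ) hm₀r E₀ h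
  · have h := evenVTable_family ha (m := m) (by omega) se (coefe j) hDq
    beta_reduce
    exact cinf_collected_rescale_eq (fun t d ↦ (![fun d : ℕ ↦ ∑ p ∈ (se.sigma fun q ↦ Finset.range (q + 1)).filter (fun p ↦ p.2 + 1 = d),
              2 * coefe j p.1 * ((-1 : ℝ) ^ p.2 * (p.1.descFactorial p.2 : ℝ) * (a ^ (p.1 - p.2) - (-a) ^ (p.1 - p.2))
                * (a / π) ^ (p.2 + 1) * (I ^ (p.2 + 1)).re) / Real.sqrt (2 * a),
              fun _ ↦ 0, fun _ ↦ 0, fun _ ↦ 0] t) d) (fun t ↦ by fin_cases t <;> simp) (![(1 : ℝ), Real.log m, -(∑ n ∈ weilPrimeIndex a, (Λ n : ℝ) / Real.sqrt n * Real.cos (π * m / a * Real.log n)), (∑ n ∈ weilPrimeIndex a, (Λ n : ℝ) / Real.sqrt n * Real.sin (π * m / a * Real.log n))]) (m : ℝ) hm₀r E₀ h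
  · exact sum_Ico_weight_sq_le hm₀2 E N

end Summit.RiemannHypothesis.RiemannHypothesis.Theorems.WeilFormatC

end
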